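import Literature.MathematicalPhysics.QuantumFieldTheory.Balaban1983to89.B9Ineq344TowerChart
import Literature.MathematicalPhysics.QuantumFieldTheory.Balaban1983to89.B9Ineq344TowerScalarEntries

/-!
# `Balaban1983to89.B9Ineq344LocalPairHolds` — [B9] (3.44)–(3.45) AT U = 1: THE LOCAL SECOND-ORDER SCHEMA
# `B9Ineq344LocalToKIdx.LocalSecondOrderKIdx` (the residual of row 11 of the N06 knit at def-Y's instance) IS A THEOREM —
# the comparison pair is the ONE-LEVEL TORUS OPERATOR `G′_{j′}` of Bałaban's scalar tower at the level of the source block,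
# charted to p21's fundamental box; its clauses (1.110)₃ ∕ (1.112) ∕ (1.113) are [B5] Prop. 1.2 for that operator (PROVED in the
# lit-balaban lineage), read through `B9Ineq344TowerScalarEntries` + `B9Ineq344TowerChart`

T. Bałaban, *Propagators for lattice gauge theories in a background field*, Commun. Math. Phys. **99** (1985) 389–434
[`Balaban1985BackgroundPropagators`, "B9"], Thm 3.1 (3.44)–(3.45) p. 398, Cor. 3.5 p. 407 (*"For … U = 1, these theorems are
proved in [4]"*); [4] = T. Bałaban, *Propagators and renormalization transformations for lattice gauge theories. II*, Commun. Math.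
Phys. **96** (1984) 223–250 [`Balaban1984PropagatorsII`], Prop. 2.2 (2.67) p. 234; [B5] = T. Bałaban, *Propagators and
renormalization transformations for lattice gauge theories. I*, Commun. Math. Phys. **95** (1984) 17–40 [`Balaban1984PropagatorsI`],
Prop. 1.2 (1.110), (1.112)–(1.113) p. 36 and the remark *"the choice of derivatives ∇G∇* is accidental"*, (1.135)–(1.137) pp. 39–40.

statement-level skeleton of published theorems with citation tags; proofs where landed; nothing here is a claim about the
Yang–Mills mass gap

THE POINT.  `LocalSecondOrderKIdx` (dag-n06-h g4, FILE 18) asks, for every k-level V1 index above a threshold, every source block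
`s′` (level `j′`) and direction `ν`, for SOME pair `(A^c, G^c)` with `G^c` symmetric, `G^cA^c = 1`, `A^c = −Δ + V^c` on functions
supported near `s′` with `V^c` an `ℓ¹`-contraction of size `C₁L^{−2j′}`, and the [B5]-Prop-1.2 clauses (1.110)₃ ∕ (1.112) ∕ (1.113)
for `G^c∂_νᵀλ`, `supp λ ⊂ B(s′)`.  The clauses on `A^c` are GLOBALLY satisfied by the one-level torus operator
`A^c = −Δ^{per} + a_{j′}L^{−2j′}Q*_{j′}Q_{j′}` of Bałaban's scalar tower at level `j′` (`B9Ineq344TowerChart.towerPairAc∕Gc∕Vc`,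
`a = 1`, `m² = 0`), and its kernel clauses are [B5] Prop. 1.2 for `G′_{j′}` on the SAME torus — theorems of the lineage
(`B5ResidualGpTorusHolds`, `B5Leaf235Torus`, `B5SecondOrderGpTorus` ∕ `B5Ineq113`), read as scalar bounds in
`B9Ineq344TowerScalarEntries` and transported by the chart `B9Ineq344TowerChart`:
* §1 the support transfer (`supp λ ⊂ B(s′)` ⇒ `supp (λ∘e) ⊂ Δ̃(y′)`), ★ (C0) `clauseC0` (`|G^c∂_νᵀλ| ≤ C₀L^{j′}|λ|`), ★ (C1) `clauseC1`
  (both `∂_κG^c∂_νᵀλ` and `∂_κᵀG^c∂_νᵀλ`, the latter by the translate `dT_transpose_mulVec`; the edge `ε = 1` by `ε ↦ min(ε, ½)`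
  and `‖λ‖_{ε′} ≤ ‖λ‖_ε + 2|λ|`), ★ (C2) `clauseC2` (near pairs `|x − x′|_T ≤ L^{j′}` by the pair form of (1.113) at
  `ε″ = min(ε, (1−β)∕2)`, far pairs by (C1) twice; the block of the pair has level `≤ j′ + 1`);
* §2 ★★★ `localSecondOrderKIdx_holds : LocalSecondOrderKIdx d ℓ hd hL b₀ b₁` (EVERY parameter; threshold `M ≥ r_loc + 3` only
  for the level window of `𝒩_{r_loc}(s′)`), hence ★★ `ineq344GpKIdx_holds`, `ineq345GpKIdx_holds` (FILE 18) and the record faces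
  ★★★ `residualGpAtOne_letters_holds`, `hGp_opsYOfLetters_holds` — ROW 11 (`hGp`) OF THE N06 KNIT AT THE RECORD'S LAYER OF
  LETTERS WITH NO HYPOTHESIS.

HONEST SCOPE.  U = 1 torus bookkeeping: every analytic input is a PROVED theorem of the lit-balaban lineage for Bałaban's scalar
torus tower; this file composes them with the typed chart.  Nothing of [B9]∕[4]∕[B5] is asserted; the letters of NODE 00 are NOT
constructed here; count-neutral; N06 NOT discharged; one finite lattice programme — nothing continuum, nothing about the mass gap.
Cell `pub-ymgap` (HUMAN RULING D-0062), Track A node N06 [B9], N06-ASSIGNMENT v1 row 11 (bundle F3), seat `pub-ymgap-dag-n06-h` (g5),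
2026-08-27.
-/

noncomputable section

namespace Literature.MathematicalPhysics.QuantumFieldTheory.Balaban1983to89.B9Ineq344LocalPairHolds

open Finset Matrix
open B4Reflection242 (boxDom)
open B4TorusKernel.MultiPeriod (torusSupNorm torusSupNorm_nonneg)
open B6MultiLevelBoxOperator (N0)
open B6MultiLevelTorusOperator (perLapT tshift unitVec)
open B6Prop22DerivMultiLevelTorus (dT dT_mulVec)
open B6Geom246MultiLevelBox (bset blkOf scale_bounds exists_blkOf_eq)
open B6Geom246MultiLevelTorus (bondT)
open B6GlobalChartV1 (PV boxEquiv boxEquiv_apply)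
open B6KLevelCensusIndexV1 (KIdx kGeo)
open B6Prop22KLevelTorusCensus (KTIdx)
open B6Prop22KLevelTorusCensusEta (hqTP hqTP_nonneg)
open B9Ineq344GpAtLetters (hqTP_add_supF_nonneg two_supF_nonneg hqTP_le_hqTP_add Ineq344GpKIdx Ineq345GpKIdx)
open B9Ineq344CutoffDatumTorus (nbhdT mem_nbhdT c0)
open B9Ineq344LocalToKIdx (rloc LocalSecondOrderKIdx ineq344GpKIdx_of_local ineq345GpKIdx_of_local
  residualGpAtOne_letters_of_local hGp_opsYOfLetters_of_local)
open B9Ineq344TowerChart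
open B5Ineq137Torus (T distX distX_nonneg supN holN holN_nonneg supN_nonneg T_symm T_nonneg eq_of_T_eq_zero)
open B5GpSettingTorus (inCube)
open B5Display136Torus (E)
open B5Display135Torus (E1)
open B9PinMembersKLevelV1 (MemberY geo9Y bg9Y)
open B7Prop2SpecialUnitary (specialUnitaryUnits)
open Node00

variable {d ℓ : ℕ} {hd : 1 ≤ d + 1} {hL : Odd (ℓ + 1) ∧ 1 < ℓ + 1} {b₀ b₁ : ℝ} {Mstar : ℕ}

/-! ## §1 The clauses of the charted one-level pair at an index and a source block -/

section Clauses

variable (i : KIdx d ℓ hd hL b₀ b₁) (s' : BlkY i)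

/-- the level of a block is a level of the tower of the index: `1 ≤ j′ ≤ k ≤ m + K`. [cite: Balaban1984PropagatorsII, (2.3)–(2.4) p.224, bookkeeping] -/
theorem level_bounds : 1 ≤ s'.1.1 ∧ s'.1.1 ≤ i.k ∧ s'.1.1 ≤ i.m + i.K :=
  ⟨(scale_bounds i.D.toDomains s').1, (scale_bounds i.D.toDomains s').2, (scale_bounds i.D.toDomains s').2.trans i.hk⟩

/-- the chart hypothesis of the index IN THE TORUS-INDEX FORM `(toKT i).NB = 2L^{m+K}` (so that every charted matrix lives
literally on `SiteY i = ↥(boxDom (toKT i).NB)`). [cite: Balaban1984PropagatorsII, (2.1) p.224, bookkeeping] -/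
theorem hNY : ∀ μ, N0 ℓ (toKT i).Mh (toKT i).k (toKT i).P μ = (PV d ℓ i.m i.K hd hL).sitesPerDir 0 := fun μ => i.hN μ

/-- `0 ≤ |λ|`. [cite: Balaban1984PropagatorsII, Prop. 2.2 (2.67) p.234 («|λ|»), bookkeeping] -/
theorem supF_nonneg (f : SiteY i → ℝ) : 0 ≤ (toKT i).supF f := by
  linarith [two_supF_nonneg (toKT i) f]

/-- `‖λ‖_{ε′} ≤ ‖λ‖_ε + 2|λ|` for `0 < ε′ ≤ ε` (pairs at distance `≤ L^k` only gain, the others are bounded by `2|λ|`).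
[cite: Balaban1984PropagatorsI, (1.109) p.35; Balaban1984PropagatorsII, Prop. 2.2 (2.67) p.234, bookkeeping] -/
theorem hqTP_mono_add {ε' ε : ℝ} (hε' : 0 < ε') (h : ε' ≤ ε) (f : SiteY i → ℝ) :
    hqTP (toKT i) ε' f ≤ hqTP (toKT i) ε f + 2 * (toKT i).supF f := by
  have := hqTP_le_hqTP_add (toKT i) hε' (sub_nonneg.2 h) f
  rwa [sub_add_cancel] at this

/-- **SUPPORT TRANSFER**: `supp λ ⊂ B(s′)` on p21's box ⇒ `supp (λ ∘ e) ⊂ Δ̃(y′)` for the [B5] cube of the block of any site of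
`B(s′)` at level `j′`. [cite: Balaban1984PropagatorsI, p.35 («supp J ⊂ Δ̃(y′)»); Balaban1984PropagatorsII, Prop. 2.2 p.234 («supp λ ⊂ B^{j′}(y′)»), dictionary] -/
theorem supp_comp {f : SiteY i → ℝ} (hf : ∀ z, f z ≠ 0 → blkOf i.D.toDomains z = s') :
    ∃ y' : Site (PV d ℓ i.m i.K hd hL) s'.1.1,
      ∀ x, (f ∘ boxEquiv (hNY i)) x ≠ 0 → inCube (PV d ℓ i.m i.K hd hL) s'.1.1 x y' := by
  obtain ⟨z₀, hz₀⟩ := exists_blkOf_eq i.D.toDomains s'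
  refine ⟨B5Ineq137Torus.blk (PV d ℓ i.m i.K hd hL) s'.1.1 ((boxEquiv (hNY i)).symm z₀), fun x hx => ?_⟩
  have hx' : blkOf i.D.toDomains (boxEquiv i.hN x) = s' := hf _ hx
  have hx₀ : blkOf i.D.toDomains (boxEquiv i.hN ((boxEquiv (hNY i)).symm z₀)) = s' := by
    have : boxEquiv i.hN ((boxEquiv (hNY i)).symm z₀) = z₀ := (boxEquiv (hNY i)).apply_symm_apply z₀
    rw [this]; exact hz₀
  exact inCube_of_blkOf_eq i hx' hx₀

/-- ★ **(C0) — (1.110)₃ FOR THE CHARTED PAIR**: `|(G^c∂_νᵀλ)(y)| ≤ C₀L^{j′}|λ|` at EVERY site, from the scalar bound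
`|(G′_{j′}∂*_ν(λ∘e))(x)| ≤ C₀|λ∘e|` (`B9Ineq344TowerScalarEntries.abs_E1_le`) and `E1_comp_eq`.
[cite: Balaban1984PropagatorsI, Prop. 1.2 (1.110) p.35; Balaban1983RegularityDecay, Lemma 2.2 (2.17) p.578; Balaban1985BackgroundPropagators, Cor. 3.5 p.407] -/
theorem clauseC0 (ν : Fin (d + 1)) {C₀ : ℝ} (hC₀ : 0 ≤ C₀)
    (hE1 : ∀ (g : Site (PV d ℓ i.m i.K hd hL) 0 → ℝ) (y' : Site (PV d ℓ i.m i.K hd hL) s'.1.1),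
      (∀ x, g x ≠ 0 → inCube (PV d ℓ i.m i.K hd hL) s'.1.1 x y') →
        ∀ x, |E1 (PV d ℓ i.m i.K hd hL) 1 0 s'.1.1 ν g x| ≤ C₀ * supN (PV d ℓ i.m i.K hd hL) g)
    (f : SiteY i → ℝ) (hf : ∀ z, f z ≠ 0 → blkOf i.D.toDomains z = s') (y : SiteY i) :
    |((towerPairGc (hNY i) 1 0 s'.1.1 * (dT (toKT i).NB ν)ᵀ) *ᵥ f) y| ≤ C₀ * ((ℓ : ℝ) + 1) ^ s'.1.1 * (toKT i).supF f := by
  obtain ⟨y', hy'⟩ := supp_comp i s' hf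
  have hLj : (0 : ℝ) < ((ℓ : ℝ) + 1) ^ s'.1.1 := by positivity
  set x := (boxEquiv (hNY i)).symm y with hx
  have hyx : y = boxEquiv (hNY i) x := by rw [hx, Equiv.apply_symm_apply]
  have hid := E1_comp_eq (hNY i) 1 0 s'.1.1 ν f x
  have hval : ((towerPairGc (hNY i) 1 0 s'.1.1 * (dT (toKT i).NB ν)ᵀ) *ᵥ f) y
      = ((ℓ : ℝ) + 1) ^ s'.1.1 * E1 (PV d ℓ i.m i.K hd hL) 1 0 s'.1.1 ν (f ∘ boxEquiv (hNY i)) x := by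
    rw [hid, ← mul_assoc, mul_inv_cancel₀ hLj.ne', one_mul, hyx]
  rw [hval, abs_mul, abs_of_pos hLj]
  have h1 := hE1 (f ∘ boxEquiv (hNY i)) y' hy' x
  have h2 : supN (PV d ℓ i.m i.K hd hL) (f ∘ boxEquiv (hNY i)) ≤ (toKT i).supF f := supN_comp_le_supF i f
  calc ((ℓ : ℝ) + 1) ^ s'.1.1 * |E1 (PV d ℓ i.m i.K hd hL) 1 0 s'.1.1 ν (f ∘ boxEquiv (hNY i)) x|
      ≤ ((ℓ : ℝ) + 1) ^ s'.1.1 * (C₀ * (toKT i).supF f) :=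
        mul_le_mul_of_nonneg_left (h1.trans (mul_le_mul_of_nonneg_left h2 hC₀)) hLj.le
    _ = C₀ * ((ℓ : ℝ) + 1) ^ s'.1.1 * (toKT i).supF f := by ring

/-- **THE SECOND-ORDER KERNEL AT EVERY SITE** (the common core of (C1) and the far pairs of (C2)): for `0 < ε′ < 1`,
`|(dT_μG^cdT_νᵀλ)(y)| ≤ C(ε′)(‖λ‖_{ε′;L^k} + |λ|)` from `abs_E_le` + `E_comp_eq` + the norm dictionary.
[cite: Balaban1984PropagatorsI, Prop. 1.2 (1.112) p.36, (1.137) p.40; Balaban1985BackgroundPropagators, (3.44) p.398] -/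
theorem kernel_bound (ν : Fin (d + 1)) {CE : ℝ → ℝ}
    (hE : ∀ ε, 0 < ε → ε < 1 → ∀ (μ : Fin (d + 1)) (g : Site (PV d ℓ i.m i.K hd hL) 0 → ℝ)
      (y' : Site (PV d ℓ i.m i.K hd hL) s'.1.1), (∀ x, g x ≠ 0 → inCube (PV d ℓ i.m i.K hd hL) s'.1.1 x y') →
        ∀ x, |E (PV d ℓ i.m i.K hd hL) 1 0 s'.1.1 μ ν g x|
          ≤ CE ε * (holN (PV d ℓ i.m i.K hd hL) s'.1.1 ε g + supN (PV d ℓ i.m i.K hd hL) g))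
    (f : SiteY i → ℝ) (hf : ∀ z, f z ≠ 0 → blkOf i.D.toDomains z = s') {ε' : ℝ} (hε0 : 0 < ε') (hε1 : ε' < 1)
    (hCE : 0 ≤ CE ε') (μ : Fin (d + 1)) (y : SiteY i) :
    |((dT (toKT i).NB μ * towerPairGc (hNY i) 1 0 s'.1.1 * (dT (toKT i).NB ν)ᵀ) *ᵥ f) y|
      ≤ CE ε' * (hqTP (toKT i) ε' f + (toKT i).supF f) := by
  obtain ⟨y', hy'⟩ := supp_comp i s' hf
  set x := (boxEquiv (hNY i)).symm y with hx
  have hyx : y = boxEquiv (hNY i) x := by rw [hx, Equiv.apply_symm_apply]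
  have hid := E_comp_eq (hNY i) 1 0 s'.1.1 μ ν f x
  have hval : ((dT (toKT i).NB μ * towerPairGc (hNY i) 1 0 s'.1.1 * (dT (toKT i).NB ν)ᵀ) *ᵥ f) y
      = E (PV d ℓ i.m i.K hd hL) 1 0 s'.1.1 μ ν (f ∘ boxEquiv (hNY i)) x := by
    rw [hid, hyx]
  rw [hval]
  have h1 := hE ε' hε0 hε1 μ (f ∘ boxEquiv (hNY i)) y' hy' x
  have h2 : supN (PV d ℓ i.m i.K hd hL) (f ∘ boxEquiv (hNY i)) ≤ (toKT i).supF f := supN_comp_le_supF i f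
  have h3 : holN (PV d ℓ i.m i.K hd hL) s'.1.1 ε' (f ∘ boxEquiv (hNY i)) ≤ hqTP (toKT i) ε' f :=
    holN_comp_le_hqTP i (level_bounds i s').2.1 hε0.le f
  exact h1.trans (mul_le_mul_of_nonneg_left (add_le_add h3 h2) hCE)

/-- `Q := ‖λ‖_α + |λ| ≥ 0` and the conversion `C(‖λ‖_{α′} + |λ|) ≤ 3C·(‖λ‖_α + |λ|)` for `0 < α′ ≤ α`, `C ≥ 0`.
[cite: Balaban1984PropagatorsI, (1.109) p.35, bookkeeping] -/
theorem conv_three {C α' α : ℝ} (hC : 0 ≤ C) (hα' : 0 < α') (h : α' ≤ α) (f : SiteY i → ℝ) :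
    C * (hqTP (toKT i) α' f + (toKT i).supF f) ≤ 3 * C * (hqTP (toKT i) α f + (toKT i).supF f) := by
  have h1 := hqTP_mono_add i hα' h f
  have h2 := hqTP_nonneg (toKT i) α f
  have h3 := supF_nonneg i f
  nlinarith

/-- ★ **(C1) — (1.112) FOR THE CHARTED PAIR, BOTH OUTER DERIVATIVES**: for `0 < ε ≤ 1`, every `κ` and EVERY site `y`,
`|(dT_κG^cdT_νᵀλ)(y)|, |(dT_κᵀG^cdT_νᵀλ)(y)| ≤ 3|C(min(ε,½))|·(‖λ‖_ε + |λ|)` — the transposed member is the plain one at the site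
`y − e_κ` («the choice of derivatives ∇G∇* is accidental»), the edge `ε = 1` through `ε′ = min(ε, ½)` and `‖λ‖_{ε′} ≤ ‖λ‖_ε + 2|λ|`.
[cite: Balaban1984PropagatorsI, Prop. 1.2 (1.112) p.36 and the remark after (1.114); Balaban1985BackgroundPropagators, (3.44) p.398, Cor. 3.5 p.407] -/
theorem clauseC1 (ν : Fin (d + 1)) {CE : ℝ → ℝ}
    (hE : ∀ ε, 0 < ε → ε < 1 → ∀ (μ : Fin (d + 1)) (g : Site (PV d ℓ i.m i.K hd hL) 0 → ℝ)
      (y' : Site (PV d ℓ i.m i.K hd hL) s'.1.1), (∀ x, g x ≠ 0 → inCube (PV d ℓ i.m i.K hd hL) s'.1.1 x y') →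
        ∀ x, |E (PV d ℓ i.m i.K hd hL) 1 0 s'.1.1 μ ν g x|
          ≤ CE ε * (holN (PV d ℓ i.m i.K hd hL) s'.1.1 ε g + supN (PV d ℓ i.m i.K hd hL) g))
    (hCE : ∀ ε, 0 < ε → ε < 1 → 0 ≤ CE ε)
    (f : SiteY i → ℝ) (hf : ∀ z, f z ≠ 0 → blkOf i.D.toDomains z = s') {ε : ℝ} (hε : 0 < ε)
    (κ : Fin (d + 1)) (y : SiteY i) :
    |(dT (toKT i).NB κ *ᵥ ((towerPairGc (hNY i) 1 0 s'.1.1 * (dT (toKT i).NB ν)ᵀ) *ᵥ f)) y|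
        ≤ 3 * |CE (min ε (1 / 2))| * (hqTP (toKT i) ε f + (toKT i).supF f) ∧
      |((dT (toKT i).NB κ)ᵀ *ᵥ ((towerPairGc (hNY i) 1 0 s'.1.1 * (dT (toKT i).NB ν)ᵀ) *ᵥ f)) y|
        ≤ 3 * |CE (min ε (1 / 2))| * (hqTP (toKT i) ε f + (toKT i).supF f) := by
  set ε' := min ε (1 / 2) with hε'
  have hε'0 : 0 < ε' := lt_min hε (by norm_num)
  have hε'1 : ε' < 1 := lt_of_le_of_lt (min_le_right _ _) (by norm_num)
  have hε'le : ε' ≤ ε := min_le_left _ _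
  have hC0 : 0 ≤ CE ε' := hCE ε' hε'0 hε'1
  have habs : |CE ε'| = CE ε' := abs_of_nonneg hC0
  -- the core bound at every site, converted to print's norm at the exponent `ε`
  have core : ∀ z, |((dT (toKT i).NB κ * towerPairGc (hNY i) 1 0 s'.1.1 * (dT (toKT i).NB ν)ᵀ) *ᵥ f) z|
      ≤ 3 * |CE ε'| * (hqTP (toKT i) ε f + (toKT i).supF f) := fun z =>
    (kernel_bound i s' ν hE f hf hε'0 hε'1 hC0 κ z).trans (by rw [habs]; exact conv_three i hC0 hε'0 hε'le f)
  constructor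
  · rw [Matrix.mulVec_mulVec, ← Matrix.mul_assoc]
    exact core y
  · rw [dT_transpose_mulVec, abs_neg, Matrix.mulVec_mulVec, ← Matrix.mul_assoc]
    exact core _

/-- the factor of the (C2) estimate: for `τ ≤ L^{j_x} − 1`... (pure real arithmetic) if `L ≥ 1`, `0 ≤ β ≤ 1`, `0 < τ`,
`L^{j_x} ≤ L·L^{j′}` then `(τ∕L^{j′})^β ≤ L·(τ∕L^{j_x})^β`. [cite: Balaban1984PropagatorsI, (1.113) p.36, bookkeeping] -/
theorem factor_near {Lr A B τ β : ℝ} (hL : 1 ≤ Lr) (hA : 0 < A) (hB : 0 < B) (hBA : B ≤ Lr * A) (hτ : 0 < τ)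
    (hβ : 0 ≤ β) (hβ1 : β ≤ 1) : (τ / A) ^ β ≤ Lr * (τ / B) ^ β := by
  have ht : 0 < τ / B := div_pos hτ hB
  have h1 : τ / A ≤ Lr * (τ / B) := by
    rw [div_le_iff₀ hA]
    calc τ = τ / B * B := by field_simp
      _ ≤ τ / B * (Lr * A) := mul_le_mul_of_nonneg_left hBA ht.le
      _ = Lr * (τ / B) * A := by ring
  calc (τ / A) ^ β ≤ (Lr * (τ / B)) ^ β := Real.rpow_le_rpow (div_pos hτ hA).le h1 hβ
    _ = Lr ^ β * (τ / B) ^ β := Real.mul_rpow (by linarith) ht.le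
    _ ≤ Lr * (τ / B) ^ β := by
        refine mul_le_mul_of_nonneg_right ?_ (Real.rpow_nonneg ht.le β)
        calc Lr ^ β ≤ Lr ^ (1 : ℝ) := Real.rpow_le_rpow_of_exponent_le hL hβ1
          _ = Lr := Real.rpow_one Lr

/-- the factor of the far pairs: if `L ≥ 1`, `0 ≤ β ≤ 1`, `A < τ` (far) and `B ≤ L·A` then `1 ≤ L·(τ∕B)^β`.
[cite: Balaban1984PropagatorsI, (1.113) p.36, bookkeeping] -/
theorem factor_far {Lr A B τ β : ℝ} (hL : 1 ≤ Lr) (hA : 0 < A) (hB : 0 < B) (hBA : B ≤ Lr * A) (hτ : A < τ)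
    (hβ : 0 ≤ β) (hβ1 : β ≤ 1) : 1 ≤ Lr * (τ / B) ^ β := by
  have ht : 0 < τ / B := div_pos (hA.trans hτ) hB
  have hLt : 1 < Lr * (τ / B) := by
    rw [mul_div_assoc', lt_div_iff₀ hB, one_mul]
    calc B ≤ Lr * A := hBA
      _ < Lr * τ := mul_lt_mul_of_pos_left hτ (by linarith)
  by_cases h1 : 1 ≤ τ / B
  · have : 1 ≤ (τ / B) ^ β := Real.one_le_rpow h1 hβ
    nlinarith
  · push Not at h1
    have h2 : τ / B ≤ (τ / B) ^ β := by
      calc τ / B = (τ / B) ^ (1 : ℝ) := (Real.rpow_one _).symm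
        _ ≤ (τ / B) ^ β := Real.rpow_le_rpow_of_exponent_ge ht h1.le hβ1
    nlinarith

/-- ★ **(C2) — (1.113) FOR THE CHARTED PAIR AS A ONE-BLOCK HÖLDER QUOTIENT**: for `0 < ε`, `0 ≤ β < 1`, two distinct sites
`x, x′`, the block of `x` of level `j_x ≤ j′ + 1` (that `x′` lies in the same block is not even needed): `|(dT_μG^cdT_νᵀλ)(x′) − (dT_μG^cdT_νᵀλ)(x)| ≤ C₃(ε,β)(|x′−x|_T∕L^{j_x})^β(‖λ‖_{β+ε} + |λ|)`
— near pairs (`|x′−x|_T ≤ L^{j′}`) by the pair form of (1.113) at `ε″ = min(ε, (1−β)∕2)`, far pairs by (1.112) at both sites.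
[cite: Balaban1984PropagatorsI, Prop. 1.2 (1.113) p.36, p.40 («The proof of (1.113) is similar»); Balaban1985BackgroundPropagators, (3.45) p.398, Cor. 3.5 p.407] -/
theorem clauseC2 (ν : Fin (d + 1)) {CE : ℝ → ℝ}
    (hE : ∀ ε, 0 < ε → ε < 1 → ∀ (μ : Fin (d + 1)) (g : Site (PV d ℓ i.m i.K hd hL) 0 → ℝ)
      (y' : Site (PV d ℓ i.m i.K hd hL) s'.1.1), (∀ x, g x ≠ 0 → inCube (PV d ℓ i.m i.K hd hL) s'.1.1 x y') →
        ∀ x, |E (PV d ℓ i.m i.K hd hL) 1 0 s'.1.1 μ ν g x|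
          ≤ CE ε * (holN (PV d ℓ i.m i.K hd hL) s'.1.1 ε g + supN (PV d ℓ i.m i.K hd hL) g))
    (hCE : ∀ ε, 0 < ε → ε < 1 → 0 ≤ CE ε) {CP : ℝ → ℝ → ℝ}
    (hP : ∀ α ε, 0 ≤ α → 0 < ε → α + ε < 1 → ∀ (μ : Fin (d + 1)) (g : Site (PV d ℓ i.m i.K hd hL) 0 → ℝ)
      (y' : Site (PV d ℓ i.m i.K hd hL) s'.1.1), (∀ x, g x ≠ 0 → inCube (PV d ℓ i.m i.K hd hL) s'.1.1 x y') →
        ∀ x₁ x₂, x₁ ≠ x₂ → distX (PV d ℓ i.m i.K hd hL) s'.1.1 x₁ x₂ ≤ 1 →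
          |E (PV d ℓ i.m i.K hd hL) 1 0 s'.1.1 μ ν g x₁ - E (PV d ℓ i.m i.K hd hL) 1 0 s'.1.1 μ ν g x₂|
            ≤ CP α ε * (holN (PV d ℓ i.m i.K hd hL) s'.1.1 (α + ε) g + supN (PV d ℓ i.m i.K hd hL) g)
              * distX (PV d ℓ i.m i.K hd hL) s'.1.1 x₁ x₂ ^ α)
    (hCP : ∀ α ε, 0 ≤ α → 0 < ε → α + ε < 1 → 0 ≤ CP α ε)
    (f : SiteY i → ℝ) (hf : ∀ z, f z ≠ 0 → blkOf i.D.toDomains z = s') {ε β : ℝ} (hε : 0 < ε)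
    (hβ : 0 ≤ β) (hβ1 : β < 1) (μ : Fin (d + 1)) (x x' : SiteY i)
    (hlev : (blkOf i.D.toDomains x).1.1 ≤ s'.1.1 + 1) (hne : x ≠ x') :
    |(dT (toKT i).NB μ *ᵥ ((towerPairGc (hNY i) 1 0 s'.1.1 * (dT (toKT i).NB ν)ᵀ) *ᵥ f)) x'
        - (dT (toKT i).NB μ *ᵥ ((towerPairGc (hNY i) 1 0 s'.1.1 * (dT (toKT i).NB ν)ᵀ) *ᵥ f)) x|
      ≤ ((ℓ : ℝ) + 1) * (3 * |CP β (min ε ((1 - β) / 2))| + 6 * |CE (min ε (1 / 2))|)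
        * (torusSupNorm (toKT i).NB (x'.1 - x.1) / ((ℓ : ℝ) + 1) ^ (blkOf i.D.toDomains x).1.1) ^ β
        * (hqTP (toKT i) (β + ε) f + (toKT i).supF f) := by
  -- notation and the basic positivity facts
  set Lr : ℝ := (ℓ : ℝ) + 1 with hLr
  set j := s'.1.1 with hj
  set jx := (blkOf i.D.toDomains x).1.1 with hjx
  set Q := hqTP (toKT i) (β + ε) f + (toKT i).supF f with hQ
  set τ := torusSupNorm (toKT i).NB (x'.1 - x.1) with hτ
  have hL1 : (1 : ℝ) ≤ Lr := by rw [hLr]; linarith [(Nat.cast_nonneg ℓ : (0 : ℝ) ≤ ℓ)]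
  have hA : 0 < Lr ^ j := pow_pos (by linarith) _
  have hB : 0 < Lr ^ jx := pow_pos (by linarith) _
  have hBA : Lr ^ jx ≤ Lr * Lr ^ j := by
    calc Lr ^ jx ≤ Lr ^ (j + 1) := pow_le_pow_right₀ hL1 hlev
      _ = Lr * Lr ^ j := by rw [pow_succ]; ring
  have hQ0 : 0 ≤ Q := hqTP_add_supF_nonneg (toKT i) (β + ε) f
  have hjk : j ≤ i.k := (level_bounds i s').2.1
  -- the chart points and the torus distance of the pair
  set a := (boxEquiv (hNY i)).symm x with ha
  set a' := (boxEquiv (hNY i)).symm x' with ha'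
  have hxa : x = boxEquiv (hNY i) a := by rw [ha, Equiv.apply_symm_apply]
  have hxa' : x' = boxEquiv (hNY i) a' := by rw [ha', Equiv.apply_symm_apply]
  have haa : a' ≠ a := fun h => hne (by rw [hxa, hxa', h])
  have hT : T (PV d ℓ i.m i.K hd hL) 0 a' a = τ := by
    rw [T_eq_torusSupNorm (hNY i), hτ]
    show torusSupNorm (toKT i).NB ((boxEquiv (hNY i) a').1 - (boxEquiv (hNY i) a).1) = _
    rw [← hxa, ← hxa']
  have hτpos : 0 < τ := by
    rcases eq_or_lt_of_le (T_nonneg (PV d ℓ i.m i.K hd hL) 0 a' a) with h0 | h0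
    · exact absurd (eq_of_T_eq_zero _ h0.symm) haa
    · rwa [hT] at h0
  have hdist : distX (PV d ℓ i.m i.K hd hL) j a' a = τ / Lr ^ j := by
    show ((((ℓ + 1 : ℕ) : ℝ)) ^ j)⁻¹ * T (PV d ℓ i.m i.K hd hL) 0 a' a = _
    rw [hT]; push_cast; rw [hLr, div_eq_inv_mul]
  -- the values at the two sites as tower kernels
  have hF : ∀ (z : SiteY i) (b : Site (PV d ℓ i.m i.K hd hL) 0), z = boxEquiv (hNY i) b →
      (dT (toKT i).NB μ *ᵥ ((towerPairGc (hNY i) 1 0 s'.1.1 * (dT (toKT i).NB ν)ᵀ) *ᵥ f)) z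
        = E (PV d ℓ i.m i.K hd hL) 1 0 j μ ν (f ∘ boxEquiv (hNY i)) b := by
    intro z b hzb
    rw [E_comp_eq (hNY i) 1 0 j μ ν f b, Matrix.mulVec_mulVec, ← Matrix.mul_assoc, hzb]
  rw [hF x' a' hxa', hF x a hxa]
  obtain ⟨y', hy'⟩ := supp_comp i s' hf
  -- exponents
  set ε₁ := min ε (1 / 2) with hε₁
  have hε₁0 : 0 < ε₁ := lt_min hε (by norm_num)
  have hε₁1 : ε₁ < 1 := lt_of_le_of_lt (min_le_right _ _) (by norm_num)
  have hε₁le : ε₁ ≤ β + ε := (min_le_left _ _).trans (by linarith)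
  set ε₂ := min ε ((1 - β) / 2) with hε₂
  have hε₂0 : 0 < ε₂ := lt_min hε (by linarith)
  have hε₂1 : β + ε₂ < 1 := by have := min_le_right ε ((1 - β) / 2); linarith
  have hε₂le : β + ε₂ ≤ β + ε := by have := min_le_left ε ((1 - β) / 2); linarith
  have hCE0 : 0 ≤ CE ε₁ := hCE ε₁ hε₁0 hε₁1
  have hCP0 : 0 ≤ CP β ε₂ := hCP β ε₂ hβ hε₂0 hε₂1
  have habsE : |CE ε₁| = CE ε₁ := abs_of_nonneg hCE0
  have habsP : |CP β ε₂| = CP β ε₂ := abs_of_nonneg hCP0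
  -- the (1.112)-bound at every chart point, in print's norm at `β + ε`
  have hfar1 : ∀ b, |E (PV d ℓ i.m i.K hd hL) 1 0 j μ ν (f ∘ boxEquiv (hNY i)) b| ≤ 3 * CE ε₁ * Q := by
    intro b
    have h1 := hE ε₁ hε₁0 hε₁1 μ (f ∘ boxEquiv (hNY i)) y' hy' b
    have h2 : supN (PV d ℓ i.m i.K hd hL) (f ∘ boxEquiv (hNY i)) ≤ (toKT i).supF f := supN_comp_le_supF i f
    have h3 : holN (PV d ℓ i.m i.K hd hL) j ε₁ (f ∘ boxEquiv (hNY i)) ≤ hqTP (toKT i) ε₁ f :=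
      holN_comp_le_hqTP i hjk hε₁0.le f
    exact (h1.trans (mul_le_mul_of_nonneg_left (add_le_add h3 h2) hCE0)).trans (conv_three i hCE0 hε₁0 hε₁le f)
  -- the common final factor
  have hfac_nonneg : 0 ≤ (τ / Lr ^ jx) ^ β := Real.rpow_nonneg (div_pos hτpos hB).le β
  have hgoal : ∀ V : ℝ, V ≤ (3 * CP β ε₂ + 6 * CE ε₁) * (Lr * (τ / Lr ^ jx) ^ β) * Q →
      V ≤ Lr * (3 * |CP β ε₂| + 6 * |CE ε₁|) * (τ / Lr ^ jx) ^ β * Q := by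
    intro V hV
    rw [habsE, habsP]
    calc V ≤ (3 * CP β ε₂ + 6 * CE ε₁) * (Lr * (τ / Lr ^ jx) ^ β) * Q := hV
      _ = Lr * (3 * CP β ε₂ + 6 * CE ε₁) * (τ / Lr ^ jx) ^ β * Q := by ring
  refine hgoal _ ?_
  by_cases hnear : τ ≤ Lr ^ j
  · -- near pairs: the pair form of (1.113)
    have hd1 : distX (PV d ℓ i.m i.K hd hL) j a' a ≤ 1 := by rw [hdist, div_le_one hA]; exact hnear
    have h1 := hP β ε₂ hβ hε₂0 hε₂1 μ (f ∘ boxEquiv (hNY i)) y' hy' a' a haa hd1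
    have h2 : supN (PV d ℓ i.m i.K hd hL) (f ∘ boxEquiv (hNY i)) ≤ (toKT i).supF f := supN_comp_le_supF i f
    have h3 : holN (PV d ℓ i.m i.K hd hL) j (β + ε₂) (f ∘ boxEquiv (hNY i)) ≤ hqTP (toKT i) (β + ε₂) f :=
      holN_comp_le_hqTP i hjk (by linarith : 0 ≤ β + ε₂) f
    have h4 : CP β ε₂ * (holN (PV d ℓ i.m i.K hd hL) j (β + ε₂) (f ∘ boxEquiv (hNY i))
        + supN (PV d ℓ i.m i.K hd hL) (f ∘ boxEquiv (hNY i))) ≤ 3 * CP β ε₂ * Q :=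
      (mul_le_mul_of_nonneg_left (add_le_add h3 h2) hCP0).trans (conv_three i hCP0 (by linarith) hε₂le f)
    have h5 : distX (PV d ℓ i.m i.K hd hL) j a' a ^ β ≤ Lr * (τ / Lr ^ jx) ^ β := by
      rw [hdist]; exact factor_near hL1 hA hB hBA hτpos hβ hβ1.le
    have hd0 : 0 ≤ distX (PV d ℓ i.m i.K hd hL) j a' a ^ β := Real.rpow_nonneg (distX_nonneg _ _ _ _) β
    calc |E (PV d ℓ i.m i.K hd hL) 1 0 j μ ν (f ∘ boxEquiv (hNY i)) a' - E (PV d ℓ i.m i.K hd hL) 1 0 j μ ν (f ∘ boxEquiv (hNY i)) a|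
        ≤ CP β ε₂ * (holN (PV d ℓ i.m i.K hd hL) j (β + ε₂) (f ∘ boxEquiv (hNY i))
            + supN (PV d ℓ i.m i.K hd hL) (f ∘ boxEquiv (hNY i))) * distX (PV d ℓ i.m i.K hd hL) j a' a ^ β := h1
      _ ≤ 3 * CP β ε₂ * Q * (Lr * (τ / Lr ^ jx) ^ β) :=
          mul_le_mul h4 h5 hd0 (mul_nonneg (mul_nonneg (by norm_num) hCP0) hQ0)
      _ ≤ 3 * CP β ε₂ * Q * (Lr * (τ / Lr ^ jx) ^ β) + 6 * CE ε₁ * (Lr * (τ / Lr ^ jx) ^ β) * Q :=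
          le_add_of_nonneg_right (mul_nonneg (mul_nonneg (mul_nonneg (by norm_num) hCE0)
            (mul_nonneg (by linarith) hfac_nonneg)) hQ0)
      _ = (3 * CP β ε₂ + 6 * CE ε₁) * (Lr * (τ / Lr ^ jx) ^ β) * Q := by ring
  · -- far pairs: (1.112) at both sites
    push Not at hnear
    have h6 := factor_far hL1 hA hB hBA hnear hβ hβ1.le
    calc |E (PV d ℓ i.m i.K hd hL) 1 0 j μ ν (f ∘ boxEquiv (hNY i)) a' - E (PV d ℓ i.m i.K hd hL) 1 0 j μ ν (f ∘ boxEquiv (hNY i)) a|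
        ≤ |E (PV d ℓ i.m i.K hd hL) 1 0 j μ ν (f ∘ boxEquiv (hNY i)) a'|
            + |E (PV d ℓ i.m i.K hd hL) 1 0 j μ ν (f ∘ boxEquiv (hNY i)) a| := abs_sub _ _
      _ ≤ 3 * CE ε₁ * Q + 3 * CE ε₁ * Q := add_le_add (hfar1 a') (hfar1 a)
      _ = 6 * CE ε₁ * Q * 1 := by ring
      _ ≤ 6 * CE ε₁ * Q * (Lr * (τ / Lr ^ jx) ^ β) :=
          mul_le_mul_of_nonneg_left h6 (mul_nonneg (mul_nonneg (by norm_num) hCE0) hQ0)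
      _ ≤ 6 * CE ε₁ * Q * (Lr * (τ / Lr ^ jx) ^ β) + 3 * CP β ε₂ * (Lr * (τ / Lr ^ jx) ^ β) * Q :=
          le_add_of_nonneg_right (mul_nonneg (mul_nonneg (mul_nonneg (by norm_num) hCP0)
            (mul_nonneg (by linarith) hfac_nonneg)) hQ0)
      _ = (3 * CP β ε₂ + 6 * CE ε₁) * (Lr * (τ / Lr ^ jx) ^ β) * Q := by ring

end Clauses

/-! ## §2 The schema holds; row 11 of the N06 knit at the layer of letters with no hypothesis -/

section Main

/-- ★★★ **`LocalSecondOrderKIdx` IS A THEOREM** (every `d, L, b₀, b₁`): at each k-level V1 index with `M ≥ r_loc + 3`, each source block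
`s′` (level `j′`) and direction `ν`, the charted ONE-LEVEL pair `(A^c, G^c, V^c) = (towerPairAc, towerPairGc, towerPairVc)` of
Bałaban's scalar torus tower at level `j′` (a = 1, m² = 0) satisfies every clause: `G^c` symmetric, `G^cA^c = 1`, `A^c = −Δ^{per} + V^c`
and `Σ|V^cu| ≤ L^{−2j′}Σ|u|` GLOBALLY, (1.110)₃ ∕ (1.112) ∕ (1.113) by [B5] Prop. 1.2 for `G′_{j′}` (`B9Ineq344TowerScalarEntries`) through
the chart (`B9Ineq344TowerChart`); the threshold only serves the level window `|j − j′| ≤ 1` on `𝒩_{r_loc}(s′)` for (1.113).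
[cite: Balaban1984PropagatorsI, Prop. 1.2 (1.110), (1.112)–(1.113) p.36, (1.135)–(1.137) pp.39–40; Balaban1984PropagatorsII, Prop. 2.2 (2.67) p.234; Balaban1985BackgroundPropagators, Thm 3.1 (3.44)–(3.45) p.398, Cor. 3.5 p.407] -/
theorem localSecondOrderKIdx_holds (d ℓ : ℕ) (hd : 1 ≤ d + 1) (hL : Odd (ℓ + 1) ∧ 1 < ℓ + 1) (b₀ b₁ : ℝ) :
    LocalSecondOrderKIdx d ℓ hd hL b₀ b₁ := by
  obtain ⟨C₀, hC₀, H0⟩ := B9Ineq344TowerScalarEntries.abs_E1_le (d + 1) (ℓ + 1) hd hL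
  obtain ⟨CE, hCE, H1⟩ := B9Ineq344TowerScalarEntries.abs_E_le (d + 1) (ℓ + 1) hd hL
  obtain ⟨CP, hCP, H2⟩ := B9Ineq344TowerScalarEntries.abs_E_sub_E_le (d + 1) (ℓ + 1) hd hL
  refine ⟨(((rloc d ℓ + 2 : ℕ) : ℝ)) + 1, max C₀ 1, fun ε => 3 * |CE (min ε (1 / 2))|,
    fun ε β => ((ℓ : ℝ) + 1) * (3 * |CP β (min ε ((1 - β) / 2))| + 6 * |CE (min ε (1 / 2))|), by positivity,
    zero_le_one.trans (le_max_right _ _), fun ε => by positivity, fun ε β => by positivity, ?_⟩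
  intro i hM s' ν
  -- index facts and the level window threshold
  have hj1 : 1 ≤ s'.1.1 := (level_bounds i s').1
  have hjK : s'.1.1 ≤ i.m + i.K := (level_bounds i s').2.2
  have hMdef : (kGeo i).M = (((ℓ + 1 : ℕ) : ℝ)) * (i.Mh : ℝ) := rfl
  have hNat : rloc d ℓ + 2 + 1 ≤ (ℓ + 1) * i.Mh := by
    rw [hMdef] at hM; exact_mod_cast hM
  have hMh1 : 1 ≤ i.Mh := le_trans (by norm_num) i.hM8
  have hPi : ∀ μ, 1 ≤ i.P' μ := (toKT i).hP
  have hR1 : 1 ≤ i.R := le_trans (by omega) (toKT i).hR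
  have hRLM : (ℓ + 1) * i.Mh ≤ i.R * ((ℓ + 1) * i.Mh) := by
    calc (ℓ + 1) * i.Mh = 1 * ((ℓ + 1) * i.Mh) := (one_mul _).symm
      _ ≤ i.R * ((ℓ + 1) * i.Mh) := Nat.mul_le_mul_right _ hR1
  have hrw : rloc d ℓ + 1 ≤ i.R * ((ℓ + 1) * i.Mh) - 1 := by omega
  -- the bounds of FILE 20 at this volume and level
  have hE1 := H0 (PV d ℓ i.m i.K hd hL) rfl rfl s'.1.1 hj1 hjK ν
  have hE := fun ε hε0 hε1 μ => H1 (PV d ℓ i.m i.K hd hL) rfl rfl s'.1.1 hj1 hjK ε hε0 hε1 μ ν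
  have hP := fun α ε hα hε0 hαε μ => H2 (PV d ℓ i.m i.K hd hL) rfl rfl s'.1.1 hj1 hjK α ε hα hε0 hαε μ ν
  refine ⟨towerPairAc (hNY i) 1 0 s'.1.1, towerPairGc (hNY i) 1 0 s'.1.1, towerPairVc (hNY i) 1 s'.1.1,
    towerPairGc_isSymm (hNY i) one_pos le_rfl hj1, towerPairGc_mul_towerPairAc (hNY i) one_pos le_rfl hj1, ?_, ?_, ?_⟩
  · -- (P3): `A^c = −Δ^{per} + V^c` on EVERY function
    intro u _
    rw [towerPairAc_eq (hNY i) 1 s'.1.1, Matrix.add_mulVec]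
  · -- (P4): `Σ|V^cu| ≤ L^{−2j′}Σ|u| ≤ C₁L^{−2j′}Σ|u|` on EVERY function
    intro u _
    refine (l1_towerPairVc_le (hNY i) one_pos hj1 hjK u).trans ?_
    exact mul_le_mul_of_nonneg_right (mul_le_mul_of_nonneg_right (le_max_right C₀ 1) (by positivity))
      (Finset.sum_nonneg fun y _ => abs_nonneg _)
  · intro f hf
    refine ⟨fun y => ?_, fun ε hε _ κ' y _ => ?_, fun ε β hε _ hβ hβ1 μ x x' _ hmem hne => ?_⟩
    · -- (C0)
      refine (clauseC0 i s' ν hC₀.le hE1 f hf y).trans ?_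
      exact mul_le_mul_of_nonneg_right (mul_le_mul_of_nonneg_right (le_max_left C₀ 1) (by positivity)) (supF_nonneg i f)
    · -- (C1)
      exact clauseC1 i s' ν hE hCE f hf hε κ' y
    · -- (C2): the block of the pair has level `≤ j′ + 1` by the level window on `𝒩_{r_loc}(s′)`
      have hdist : (bondT i.D).dist (blkOf i.D.toDomains x) s' ≤ rloc d ℓ := (mem_nbhdT i.D).1 hmem
      have hlev : (blkOf i.D.toDomains x).1.1 ≤ s'.1.1 + 1 :=
        (B9Ineq346SecondOrderTorusCutoff.scale_window_of_distT_le i.D hMh1 hPi hrw s' (blkOf i.D.toDomains x) hdist).2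
      exact clauseC2 i s' ν hE hCE hP hCP f hf hε hβ hβ1 μ x x' hlev hne

variable (d ℓ : ℕ) (hd : 1 ≤ d + 1) (hL : Odd (ℓ + 1) ∧ 1 < ℓ + 1) (b₀ b₁ : ℝ) in
/-- `LocalSecondOrderKIdx` — `_holds` alias of `localSecondOrderKIdx_holds` above under the fact's exact name, stated under the
prover's own binders as section variables (appended 2026-08-28, D-0026 bookkeeping: the proof term is the
existing theorem of this file; no statement, definition or attribute is edited; no new named fact; the
ledger's debt table listed the fact unproved). [cite: Balaban1984PropagatorsI, Prop. 1.2 (1.110), (1.112)–(1.113) p.36, (1.135)–(1.137) pp.39–40; Balaban1984PropagatorsII, Prop. 2.2 (2.67) p.234; Balaban1985BackgroundPropagators, Thm 3.1 (3.44)–(3.45) p.398, Cor. 3.5 p.407] -/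
theorem _root_.Literature.MathematicalPhysics.QuantumFieldTheory.Balaban1983to89.B9Ineq344LocalToKIdx.LocalSecondOrderKIdx_holds :
    _root_.Literature.MathematicalPhysics.QuantumFieldTheory.Balaban1983to89.B9Ineq344LocalToKIdx.LocalSecondOrderKIdx d ℓ hd hL b₀ b₁ :=
  _root_.Literature.MathematicalPhysics.QuantumFieldTheory.Balaban1983to89.B9Ineq344LocalPairHolds.localSecondOrderKIdx_holds (d := d) (ℓ := ℓ) (hd := hd) (hL := hL) (b₀ := b₀) (b₁ := b₁)

/-- ★★ **THE FLAT SCHEMA (3.44) `Ineq344GpKIdx` HOLDS** (FILE 18's `ineq344GpKIdx_of_local` with the local schema discharged).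
[cite: Balaban1985BackgroundPropagators, Thm 3.1 (3.44) p.398, Cor. 3.5 p.407; Balaban1984PropagatorsI, Prop. 1.2 (1.112) p.36] -/
theorem ineq344GpKIdx_holds (d ℓ : ℕ) (hd : 1 ≤ d + 1) (hL : Odd (ℓ + 1) ∧ 1 < ℓ + 1) (b₀ b₁ : ℝ) :
    Ineq344GpKIdx d ℓ hd hL b₀ b₁ :=
  ineq344GpKIdx_of_local (localSecondOrderKIdx_holds d ℓ hd hL b₀ b₁)

variable (d ℓ : ℕ) (hd : 1 ≤ d + 1) (hL : Odd (ℓ + 1) ∧ 1 < ℓ + 1) (b₀ b₁ : ℝ) in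
/-- `Ineq344GpKIdx` — `_holds` alias of `ineq344GpKIdx_holds` above under the fact's exact name, stated under the
prover's own binders as section variables (appended 2026-08-28, D-0026 bookkeeping: the proof term is the
existing theorem of this file; no statement, definition or attribute is edited; no new named fact; the
ledger's debt table listed the fact unproved). [cite: Balaban1985BackgroundPropagators, Thm 3.1 (3.44) p.398, Cor. 3.5 p.407; Balaban1984PropagatorsI, Prop. 1.2 (1.112) p.36] -/
theorem _root_.Literature.MathematicalPhysics.QuantumFieldTheory.Balaban1983to89.B9Ineq344GpAtLetters.Ineq344GpKIdx_holds :
    _root_.Literature.MathematicalPhysics.QuantumFieldTheory.Balaban1983to89.B9Ineq344GpAtLetters.Ineq344GpKIdx d ℓ hd hL b₀ b₁ :=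
  _root_.Literature.MathematicalPhysics.QuantumFieldTheory.Balaban1983to89.B9Ineq344LocalPairHolds.ineq344GpKIdx_holds (d := d) (ℓ := ℓ) (hd := hd) (hL := hL) (b₀ := b₀) (b₁ := b₁)

/-- ★★ **THE FLAT SCHEMA (3.45) `Ineq345GpKIdx` HOLDS** (FILE 18's `ineq345GpKIdx_of_local` with the local schema discharged).
[cite: Balaban1985BackgroundPropagators, Thm 3.1 (3.45) p.398, Cor. 3.5 p.407; Balaban1984PropagatorsI, Prop. 1.2 (1.113) p.36] -/
theorem ineq345GpKIdx_holds (d ℓ : ℕ) (hd : 1 ≤ d + 1) (hL : Odd (ℓ + 1) ∧ 1 < ℓ + 1) (b₀ b₁ : ℝ) :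
    Ineq345GpKIdx d ℓ hd hL b₀ b₁ :=
  ineq345GpKIdx_of_local (localSecondOrderKIdx_holds d ℓ hd hL b₀ b₁)

variable (d ℓ : ℕ) (hd : 1 ≤ d + 1) (hL : Odd (ℓ + 1) ∧ 1 < ℓ + 1) (b₀ b₁ : ℝ) in
/-- `Ineq345GpKIdx` — `_holds` alias of `ineq345GpKIdx_holds` above under the fact's exact name, stated under the
prover's own binders as section variables (appended 2026-08-28, D-0026 bookkeeping: the proof term is the
existing theorem of this file; no statement, definition or attribute is edited; no new named fact; the
ledger's debt table listed the fact unproved). [cite: Balaban1985BackgroundPropagators, Thm 3.1 (3.45) p.398, Cor. 3.5 p.407; Balaban1984PropagatorsI, Prop. 1.2 (1.113) p.36] -/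
theorem _root_.Literature.MathematicalPhysics.QuantumFieldTheory.Balaban1983to89.B9Ineq344GpAtLetters.Ineq345GpKIdx_holds :
    _root_.Literature.MathematicalPhysics.QuantumFieldTheory.Balaban1983to89.B9Ineq344GpAtLetters.Ineq345GpKIdx d ℓ hd hL b₀ b₁ :=
  _root_.Literature.MathematicalPhysics.QuantumFieldTheory.Balaban1983to89.B9Ineq344LocalPairHolds.ineq345GpKIdx_holds (d := d) (ℓ := ℓ) (hd := hd) (hL := hL) (b₀ := b₀) (b₁ := b₁)

end Main

/-! ## §3 Record faces: row `hGp` at NODE 00's layer of letters, unconditionally -/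

section Record

variable {𝔸 : Type} [NormedRing 𝔸] [NormedAlgebra ℂ 𝔸] [CompleteSpace 𝔸]
variable {G : Subgroup 𝔸ˣ} (𝔏 : ∀ x : MemberY d ℓ hd hL b₀ b₁ Mstar, CovLettersY 𝔸 x)
  (𝔈 : ∀ x : MemberY d ℓ hd hL b₀ b₁ Mstar, ExpLettersY 𝔸 G x)

/-- ★★★ **ROW `hGp` AT NODE 00's LAYER OF LETTERS, NO HYPOTHESIS** (every `𝔏 𝔈`): `B9FromB6.ResidualGpAtOne` for the `Gp`-member
of `operatorLayerYOfLetters` — FILE 18's `residualGpAtOne_letters_of_local` with `LocalSecondOrderKIdx` discharged.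
[cite: Balaban1985BackgroundPropagators, Cor. 3.5 p.407 + Thm 3.1 (3.43)–(3.47) p.398; Balaban1984PropagatorsII, Prop. 2.2 (2.67), Lemma 2.1 p.234; Balaban1984PropagatorsI, Prop. 1.2 (1.110)–(1.113) p.36] -/
theorem residualGpAtOne_letters_holds :
    B9FromB6.ResidualGpAtOne geo9Y (bg9Y 𝔸 G) (fun x => (operatorLayerYOfLetters 𝔸 G x (𝔏 x) (𝔈 x)).Gp) :=
  residualGpAtOne_letters_of_local 𝔏 𝔈 (localSecondOrderKIdx_holds d ℓ hd hL b₀ b₁)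

open scoped Matrix.Norms.L2Operator in
/-- ★★★ **ROW `hGp` OF THE N06 KNIT AT THE RECORD'S LAYER OF LETTERS, NO HYPOTHESIS** — conclusion LITERALLY the knit binder `hGp`
at `ops := opsYOfLetters N θ M⋆ 𝔏 𝔈` (FILE 18's `hGp_opsYOfLetters_of_local` with `LocalSecondOrderKIdx` discharged: the binder
`hloc` of the knit DROPS). [cite: Balaban1985BackgroundPropagators, Cor. 3.5 p.407 + Thm 3.1 (3.43)–(3.47) p.398; Balaban1984PropagatorsI, Prop. 1.2 (1.110)–(1.113) p.36] -/
theorem hGp_opsYOfLetters_holds (N : ℕ) (θ : Stage3Params) (Mstar' : ℕ) (𝔏 : LettersY N θ Mstar')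
    (𝔈 : ExpsY N θ Mstar') :
    B9FromB6.ResidualGpAtOne geo9Y (bg9Y (Matrix (Fin N) (Fin N) ℂ) (specialUnitaryUnits (Fin N)))
      (fun x => (opsYOfLetters N θ Mstar' 𝔏 𝔈 x).Gp) :=
  hGp_opsYOfLetters_of_local N θ Mstar' 𝔏 𝔈 (localSecondOrderKIdx_holds θ.d₆ θ.ℓ₆ θ.hd' θ.hL' θ.b₀ θ.b₁)

end Record

end Literature.MathematicalPhysics.QuantumFieldTheory.Balaban1983to89.B9Ineq344LocalPairHolds

end
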